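import Literature.MathematicalPhysics.QuantumManyBody.YukawaShortCutoff
import HarnessLib

/-!
# Lieb–Solovej Lemma 4.1, electrostatic part: long and short distance cutoffs

Topic `Literature/MathematicalPhysics/QuantumManyBody` (electrostatics groundwork for the charged
Bose gas, `JelliumBoseGas.foldyLaw`; assembly of `YukawaCutoffError.lean` and
`YukawaShortCutoff.lean`). [LiebSolovej2001, Lemma 4.1]: in a box after the sliding localization
the jellium energy is computed with the Yukawa kernel `Y_ν`, `ν = ω(t)/ℓ`, weights
`cᵢ = χ_ℓ(xᵢ) ∈ [0, 1]` on the particles and the background `g = ρχ_ℓ ∈ [0, ρ]`; replacing `Y_ν` by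
the doubly cut-off kernel `V_{r,R} = Y_{R⁻¹} - Y_{r⁻¹}` (`ν ≤ R⁻¹ ≤ r⁻¹`) costs at most
`½ n R⁻¹ + const · nρr²`:

`𝓤[Y_ν] ≥ 𝓤[Y_{R⁻¹} - Y_{r⁻¹}] - ½ n (R⁻¹ - ν) - 4π n ρ r²`,
`𝓤[k] = ∑_{i<j} cᵢcⱼ k(xᵢ - xⱼ) - ∑ᵢ cᵢ ∫ g(y) k(xᵢ - y) dy + ½ ∬ g(x) g(y) k(x - y) dx dy`

((4.3): `Y_ν - Y_{R⁻¹}` is of positive type with value `R⁻¹ - ν` at the origin; (4.4): dropping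
`Y_{r⁻¹} ≥ 0` lowers the repulsive terms and costs `≤ nρ ∫ Y_{r⁻¹} = 4π nρr²` in the attractive
one). This file proves exactly this statement in the tree's subordinated normalisation
`K_μ(z) = ∫₀^∞ e^{-μs} G_s(z) ds = Y_{√μ}(z)/(4π)` (all kernels divided by `4π`):

* `Coulomb.yukawaKernel_split` — `K_{ν²} = W_{ν,R⁻¹} + K_{R⁻²}` off the origin,
  `W_{a,b} = ∫₀^∞ (e^{-a²s} - e^{-b²s}) G_s ds`;
* `Coulomb.integrable_background_yukawa`, `integrable_prod_background_yukawa` — the particle–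
  background and background–background integrands of a bounded `L¹` background are integrable;
* `Coulomb.coulombCutoff_electrostatic` — **the displayed inequality** (kernels `/4π`: the
  error is `-½ (R⁻¹ - ν)/(4π) ∑ cᵢ² - n ρ̄ r²`, `∑ cᵢ² ≤ n`).

What is NOT here: the kinetic (Neumann) part of Lemma 4.1 and the bookkeeping of `χ_ℓ`, `γ`,
`ω(t)`; the sliding lemma [LiebSolovej2001, Lemma 3.1] (positivity of the Fourier transform of
`|x|⁻¹ - h(x)Y_ω(x)`, [CLY, Lemma 2.1]).

## References

* [LiebSolovej2001] E. H. Lieb, J. P. Solovej, Commun. Math. Phys. 217 (2001) 127–163, §4,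
  (4.1)–(4.4), Lemma 4.1 (arXiv:cond-mat/0007425, p. 10).
-/

noncomputable section

open MeasureTheory Set Filter Real
open scoped ENNReal NNReal Topology
open Literature.Analysis.UnboundedOperators

namespace Literature.MathematicalPhysics.QuantumManyBody.Coulomb

open BoseGas

/-! ### Splitting the Yukawa kernel -/

/-- Off the origin, `K_{a²} = W_{a,b} + K_{b²}`: `∫₀^∞ e^{-a²s}G_s(z)ds =
∫₀^∞ (e^{-a²s} - e^{-b²s})G_s(z)ds + ∫₀^∞ e^{-b²s}G_s(z)ds` (`z ≠ 0`, `0 < a`, `0 < b`).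
[cite: LiebSolovej2001, §4 (4.2)] -/
theorem yukawaKernel_split {a b : ℝ} (ha : 0 < a) (hb : 0 < b) {z : Space} (hz : z ≠ 0) :
    ∫ s in Ioi (0 : ℝ), Real.exp (-(a ^ 2 * s)) * heatKernel s z =
      (∫ s in Ioi (0 : ℝ), (Real.exp (-(a ^ 2 * s)) - Real.exp (-(b ^ 2 * s))) * heatKernel s z) +
        ∫ s in Ioi (0 : ℝ), Real.exp (-(b ^ 2 * s)) * heatKernel s z := by
  have hia := (integral_Ioi_exp_neg_mul_heatKernel hz (by positivity : 0 < a ^ 2)).1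
  have hib := (integral_Ioi_exp_neg_mul_heatKernel hz (by positivity : 0 < b ^ 2)).1
  simp_rw [sub_mul]
  rw [integral_sub hia hib]
  ring

/-- The Yukawa kernel is nonnegative: `0 ≤ K_μ(z)`. [folklore] -/
theorem yukawaKernel_nonneg (μ : ℝ) (z : Space) :
    0 ≤ ∫ s in Ioi (0 : ℝ), Real.exp (-(μ * s)) * heatKernel s z :=
  setIntegral_nonneg measurableSet_Ioi fun s hs =>
    mul_nonneg (Real.exp_pos _).le (heatKernel_pos (show (0:ℝ) < s from hs) z).le

/-! ### Integrability of the background terms -/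

/-- For `μ > 0` and a measurable background `|g| ≤ ρ̄`, `y ↦ g(y) K_μ(x - y)` is integrable.
[folklore] -/
theorem integrable_background_yukawa {μ : ℝ} (hμ : 0 < μ) {g : Space → ℝ} (hgm : Measurable g)
    {ρbar : ℝ} (hC : ∀ y, |g y| ≤ ρbar) (x : Space) :
    Integrable fun y : Space => g y * ∫ s in Ioi (0 : ℝ), Real.exp (-(μ * s)) * heatKernel s (x - y) := by
  obtain ⟨-, hKi, -⟩ := integral_yukawaKernel hμ
  refine (hKi.comp_sub_left x).bdd_mul (c := ρbar) hgm.aestronglyMeasurable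
    (Eventually.of_forall fun y => ?_)
  rw [Real.norm_eq_abs]
  exact hC y

/-- For `μ > 0` and a measurable background `0 ≤ g ≤ ρ̄` in `L¹(ℝ³)`, the background–background
integrand `g(x) g(y) K_μ(x - y)` is integrable on `ℝ³ × ℝ³` (Tonelli and
`∫ g(y)K_μ(x - y)dy ≤ ρ̄/μ`). [folklore] -/
theorem integrable_prod_background_yukawa {μ : ℝ} (hμ : 0 < μ) {g : Space → ℝ} (hgm : Measurable g)
    (hg : Integrable g) {ρbar : ℝ} (h0 : ∀ y, 0 ≤ g y) (h1 : ∀ y, g y ≤ ρbar) :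
    Integrable (fun z : Space × Space =>
      g z.1 * g z.2 * ∫ s in Ioi (0 : ℝ), Real.exp (-(μ * s)) * heatKernel s (z.1 - z.2))
      (volume.prod volume) := by
  obtain ⟨hKm, -, -⟩ := integral_yukawaKernel hμ
  have hC : ∀ y, |g y| ≤ ρbar := fun y => by rw [abs_of_nonneg (h0 y)]; exact h1 y
  have hFm : Measurable fun z : Space × Space =>
      g z.1 * g z.2 * ∫ s in Ioi (0 : ℝ), Real.exp (-(μ * s)) * heatKernel s (z.1 - z.2) :=
    ((hgm.comp measurable_fst).mul (hgm.comp measurable_snd)).mul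
      (hKm.comp (measurable_fst.sub measurable_snd))
  have hnn : ∀ z : Space × Space,
      0 ≤ g z.1 * g z.2 * ∫ s in Ioi (0 : ℝ), Real.exp (-(μ * s)) * heatKernel s (z.1 - z.2) :=
    fun z => mul_nonneg (mul_nonneg (h0 _) (h0 _)) (yukawaKernel_nonneg _ _)
  refine ⟨hFm.aestronglyMeasurable, (hasFiniteIntegral_iff_ofReal (Eventually.of_forall hnn)).2 ?_⟩
  rw [lintegral_prod (fun z : Space × Space => ENNReal.ofReal (g z.1 * g z.2 *
      ∫ s in Ioi (0 : ℝ), Real.exp (-(μ * s)) * heatKernel s (z.1 - z.2)))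
    (ENNReal.measurable_ofReal.comp hFm).aemeasurable]
  have hinner : ∀ x : Space, ∫⁻ y, ENNReal.ofReal (g x * g y *
      ∫ s in Ioi (0 : ℝ), Real.exp (-(μ * s)) * heatKernel s (x - y)) ≤
      ENNReal.ofReal (g x) * ENNReal.ofReal (ρbar / μ) := by
    intro x
    have e : ∀ y, ENNReal.ofReal (g x * g y *
        ∫ s in Ioi (0 : ℝ), Real.exp (-(μ * s)) * heatKernel s (x - y)) =
        ENNReal.ofReal (g x) * ENNReal.ofReal (g y *
          ∫ s in Ioi (0 : ℝ), Real.exp (-(μ * s)) * heatKernel s (x - y)) := by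
      intro y
      rw [mul_assoc, ENNReal.ofReal_mul (h0 x)]
    simp_rw [e]
    rw [lintegral_const_mul' _ _ ENNReal.ofReal_ne_top,
      ← ofReal_integral_eq_lintegral_ofReal (integrable_background_yukawa hμ hgm hC x)
        (Eventually.of_forall fun y => mul_nonneg (h0 y) (yukawaKernel_nonneg _ _))]
    exact mul_le_mul' le_rfl (ENNReal.ofReal_le_ofReal (integral_background_yukawa_le hμ h0 h1 x))
  calc ∫⁻ x, ∫⁻ y, ENNReal.ofReal (g x * g y *
        ∫ s in Ioi (0 : ℝ), Real.exp (-(μ * s)) * heatKernel s (x - y))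
      ≤ ∫⁻ x, ENNReal.ofReal (g x) * ENNReal.ofReal (ρbar / μ) := lintegral_mono hinner
    _ = (∫⁻ x, ENNReal.ofReal (g x)) * ENNReal.ofReal (ρbar / μ) :=
        lintegral_mul_const _ hgm.ennreal_ofReal
    _ < ⊤ := by
        refine ENNReal.mul_lt_top ?_ ENNReal.ofReal_lt_top
        have h := hg.2
        rw [HasFiniteIntegral] at h
        refine lt_of_le_of_lt (lintegral_mono fun x => ?_) h
        rw [Real.enorm_eq_ofReal (h0 x)]

/-! ### Lemma 4.1, electrostatic part -/

/-- **Lieb–Solovej Lemma 4.1, electrostatic part** [LiebSolovej2001, (4.3)–(4.4)]. Let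
`0 < ν ≤ R⁻¹`, `0 < r ≤ R`, let `x₁, …, x_N ∈ ℝ³` be distinct points with weights
`cᵢ ∈ [0, 1]`, and let `g` be a measurable background with `0 ≤ g ≤ ρ̄`, `g ∈ L¹(ℝ³)`. With the
kernels (all `/4π`) `Kν = Y_ν/4π = ∫₀^∞ e^{-ν²s}G_s ds`,
`V = (Y_{R⁻¹} - Y_{r⁻¹})/4π = ∫₀^∞ (e^{-s/R²} - e^{-s/r²})G_s ds` and the jellium functional
`𝓤[k] = ∑_{i<j} cᵢcⱼ k(xᵢ - xⱼ) - ∑ᵢ cᵢ ∫ g(y) k(xᵢ - y) dy + ½∬ g(x)g(y)k(x - y)`,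
`𝓤[Kν] ≥ 𝓤[V] - ½ (R⁻¹ - ν)/(4π) ∑ᵢ cᵢ² - N ρ̄ r²`.
The hypotheses `hKν`, `hW`, `hKR`, `hV` only name the four kernels. [cite: LiebSolovej2001, Lemma 4.1] -/
theorem coulombCutoff_electrostatic {ν r R : ℝ} (hν : 0 < ν) (hνR : ν ≤ R⁻¹) (hr : 0 < r)
    (hrR : r ≤ R) {N : ℕ} {X : Fin N → Space} (hX : Function.Injective X) {c : Fin N → ℝ}
    (hc0 : ∀ i, 0 ≤ c i) (hc1 : ∀ i, c i ≤ 1) {g : Space → ℝ} (hgm : Measurable g)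
    (hg : Integrable g) {ρbar : ℝ} (h0 : ∀ y, 0 ≤ g y) (h1 : ∀ y, g y ≤ ρbar)
    {Kν W KR V : Space → ℝ}
    (hKν : Kν = fun z => ∫ s in Ioi (0 : ℝ), Real.exp (-(ν ^ 2 * s)) * heatKernel s z)
    (hW : W = fun z => ∫ s in Ioi (0 : ℝ),
      (Real.exp (-(ν ^ 2 * s)) - Real.exp (-((R⁻¹) ^ 2 * s))) * heatKernel s z)
    (hKR : KR = fun z => ∫ s in Ioi (0 : ℝ), Real.exp (-((R⁻¹) ^ 2 * s)) * heatKernel s z)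
    (hV : V = fun z => ∫ s in Ioi (0 : ℝ),
      (Real.exp (-((R⁻¹) ^ 2 * s)) - Real.exp (-((r⁻¹) ^ 2 * s))) * heatKernel s z) :
    (∑ i, ∑ j with i < j, c i * c j * V (X i - X j)) - (∑ i, c i * ∫ y, g y * V (X i - y)) +
        1 / 2 * ∫ z : Space × Space, g z.1 * g z.2 * V (z.1 - z.2) ∂(volume.prod volume) -
        1 / 2 * ((R⁻¹ - ν) / (4 * π)) * (∑ i, c i ^ 2) - N * ρbar * r ^ 2 ≤
      (∑ i, ∑ j with i < j, c i * c j * Kν (X i - X j)) - (∑ i, c i * ∫ y, g y * Kν (X i - y)) +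
        1 / 2 * ∫ z : Space × Space, g z.1 * g z.2 * Kν (z.1 - z.2) ∂(volume.prod volume) := by
  have hR : 0 < R := hr.trans_le hrR
  have hRi : 0 < R⁻¹ := inv_pos.2 hR
  have hri : 0 < r⁻¹ := inv_pos.2 hr
  have hRr : R⁻¹ ≤ r⁻¹ := (inv_le_inv₀ hR hr).2 hrR
  have hC : ∀ y, |g y| ≤ ρbar := fun y => by rw [abs_of_nonneg (h0 y)]; exact h1 y
  -- the kernel `Kr`
  set Kr : Space → ℝ := fun z => ∫ s in Ioi (0 : ℝ), Real.exp (-((r⁻¹) ^ 2 * s)) * heatKernel s z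
    with hKr
  -- pointwise splittings off the origin
  have hsplit1 : ∀ z : Space, z ≠ 0 → Kν z = W z + KR z := by
    intro z hz
    rw [hKν, hW, hKR]
    exact yukawaKernel_split hν hRi hz
  have hsplit2 : ∀ z : Space, z ≠ 0 → KR z = V z + Kr z := by
    intro z hz
    rw [hKR, hV, hKr]
    exact yukawaKernel_split hRi hri hz
  have hKr0 : ∀ z, 0 ≤ Kr z := fun z => yukawaKernel_nonneg _ _
  -- (1) particle–particle terms
  have hpp : ∑ i, ∑ j with i < j, c i * c j * Kν (X i - X j) ≥
      (∑ i, ∑ j with i < j, c i * c j * W (X i - X j)) +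
        ∑ i, ∑ j with i < j, c i * c j * V (X i - X j) := by
    rw [← Finset.sum_add_distrib]
    refine Finset.sum_le_sum fun i _ => ?_
    rw [← Finset.sum_add_distrib]
    refine Finset.sum_le_sum fun j hj => ?_
    have hij : i < j := (Finset.mem_filter.1 hj).2
    have hz : X i - X j ≠ 0 := sub_ne_zero.2 (hX.ne hij.ne)
    rw [hsplit1 _ hz, hsplit2 _ hz]
    have : 0 ≤ c i * c j * Kr (X i - X j) := mul_nonneg (mul_nonneg (hc0 i) (hc0 j)) (hKr0 _)
    nlinarith
  -- (2) particle–background terms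
  have hν2 : 0 < ν ^ 2 := by positivity
  have hR2 : 0 < (R⁻¹) ^ 2 := by positivity
  have hpb_split : ∀ i, ∫ y, g y * Kν (X i - y) = (∫ y, g y * W (X i - y)) + ∫ y, g y * KR (X i - y) := by
    intro i
    have hae : ∀ᵐ y : Space ∂volume, y ≠ X i := by
      have : (volume : Measure Space) {y | ¬y ≠ X i} = 0 := by
        simp only [ne_eq, not_not, setOf_eq_eq_singleton, measure_singleton]
      exact ae_iff.2 this
    have hiν : Integrable fun y : Space => g y * Kν (X i - y) := by
      rw [hKν]; exact integrable_background_yukawa hν2 hgm hC (X i)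
    have hiR : Integrable fun y : Space => g y * KR (X i - y) := by
      rw [hKR]; exact integrable_background_yukawa hR2 hgm hC (X i)
    have hiW : Integrable fun y : Space => g y * W (X i - y) := by
      refine (hiν.sub hiR).congr ?_
      filter_upwards [hae] with y hy
      have hz : X i - y ≠ 0 := sub_ne_zero.2 (Ne.symm hy)
      show g y * Kν (X i - y) - g y * KR (X i - y) = g y * W (X i - y)
      rw [hsplit1 _ hz]
      ring
    rw [← integral_add hiW hiR]
    refine integral_congr_ae ?_
    filter_upwards [hae] with y hy
    have hz : X i - y ≠ 0 := sub_ne_zero.2 (Ne.symm hy)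
    rw [hsplit1 _ hz]
    ring
  have hpb_short : -(∑ i, c i * ∫ y, g y * V (X i - y)) - N * ρbar * r ^ 2 ≤
      -(∑ i, c i * ∫ y, g y * KR (X i - y)) := by
    have h := attractive_shortCutoff_ge hr hrR hc1 X hgm h0 h1
    rw [hV, hKR]
    exact h
  have hpb : -(∑ i, c i * ∫ y, g y * Kν (X i - y)) ≥
      -(∑ i, c i * ∫ y, g y * W (X i - y)) - (∑ i, c i * ∫ y, g y * V (X i - y)) - N * ρbar * r ^ 2 := by
    have e : ∑ i, c i * ∫ y, g y * Kν (X i - y) =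
        (∑ i, c i * ∫ y, g y * W (X i - y)) + ∑ i, c i * ∫ y, g y * KR (X i - y) := by
      rw [← Finset.sum_add_distrib]
      refine Finset.sum_congr rfl fun i _ => ?_
      rw [hpb_split i]
      ring
    rw [e]
    linarith
  -- (3) background–background terms
  have hbbν : Integrable (fun z : Space × Space => g z.1 * g z.2 * Kν (z.1 - z.2)) (volume.prod volume) := by
    rw [hKν]; exact integrable_prod_background_yukawa hν2 hgm hg h0 h1
  have hbbR : Integrable (fun z : Space × Space => g z.1 * g z.2 * KR (z.1 - z.2)) (volume.prod volume) := by
    rw [hKR]; exact integrable_prod_background_yukawa hR2 hgm hg h0 h1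
  have hbbr : Integrable (fun z : Space × Space => g z.1 * g z.2 * Kr (z.1 - z.2)) (volume.prod volume) := by
    rw [hKr]; exact integrable_prod_background_yukawa (by positivity) hgm hg h0 h1
  have hbbW : Integrable (fun z : Space × Space => g z.1 * g z.2 * W (z.1 - z.2)) (volume.prod volume) := by
    refine (hbbν.sub hbbR).congr ?_
    filter_upwards [ae_fst_ne_snd] with z hz
    have hz' : z.1 - z.2 ≠ 0 := sub_ne_zero.2 hz
    show g z.1 * g z.2 * Kν (z.1 - z.2) - g z.1 * g z.2 * KR (z.1 - z.2) = g z.1 * g z.2 * W (z.1 - z.2)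
    rw [hsplit1 _ hz']
    ring
  have hbbV : Integrable (fun z : Space × Space => g z.1 * g z.2 * V (z.1 - z.2)) (volume.prod volume) := by
    refine (hbbR.sub hbbr).congr ?_
    filter_upwards [ae_fst_ne_snd] with z hz
    have hz' : z.1 - z.2 ≠ 0 := sub_ne_zero.2 hz
    show g z.1 * g z.2 * KR (z.1 - z.2) - g z.1 * g z.2 * Kr (z.1 - z.2) = g z.1 * g z.2 * V (z.1 - z.2)
    rw [hsplit2 _ hz']
    ring
  have hbb_split : ∫ z : Space × Space, g z.1 * g z.2 * Kν (z.1 - z.2) ∂(volume.prod volume) =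
      (∫ z : Space × Space, g z.1 * g z.2 * W (z.1 - z.2) ∂(volume.prod volume)) +
        ∫ z : Space × Space, g z.1 * g z.2 * KR (z.1 - z.2) ∂(volume.prod volume) := by
    rw [← integral_add hbbW hbbR]
    refine integral_congr_ae ?_
    filter_upwards [ae_fst_ne_snd] with z hz
    rw [hsplit1 _ (sub_ne_zero.2 hz)]
    ring
  have hbb_short : ∫ z : Space × Space, g z.1 * g z.2 * V (z.1 - z.2) ∂(volume.prod volume) ≤
      ∫ z : Space × Space, g z.1 * g z.2 * KR (z.1 - z.2) ∂(volume.prod volume) := by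
    refine integral_mono_ae hbbV hbbR ?_
    filter_upwards [ae_fst_ne_snd] with z hz
    rw [hsplit2 _ (sub_ne_zero.2 hz)]
    have : 0 ≤ g z.1 * g z.2 * Kr (z.1 - z.2) := mul_nonneg (mul_nonneg (h0 _) (h0 _)) (hKr0 _)
    nlinarith
  -- (4) the positive-type error kernel `W = Kν - KR`
  have hWpos : -(1 / 2 * ((R⁻¹ - ν) / (4 * π)) * ∑ i, c i ^ 2) ≤
      (∑ i, ∑ j with i < j, c i * c j * W (X i - X j)) - (∑ i, c i * ∫ y, g y * W (X i - y)) +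
        1 / 2 * ∫ z : Space × Space, g z.1 * g z.2 * W (z.1 - z.2) ∂(volume.prod volume) := by
    have h := yukawaCutoff_points_ge hν hνR c X hgm hg
    rw [hW]
    exact h
  -- assemble
  rw [hbb_split]
  linarith [hpp, hpb, hbb_short, hWpos]

end Literature.MathematicalPhysics.QuantumManyBody.Coulomb
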